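import Literature.Computability.Complexity.TM2Window
import Mathlib.Data.Nat.Digits.Defs
import Mathlib.Data.Nat.Size
import Mathlib.Data.Fintype.Card
import Mathlib.Logic.Equiv.Fin.Basic
import HarnessLib

/-!
# Numeric coding of the configurations of a multi-stack (TM2) machine and of its local step

Topic `Literature/Computability/Complexity`.  Second machine-level layer of the arithmetisation of
polynomial-time `TM2` computations inside Buss's `S₂¹` (Buss 1986, Ch. 3; Krajíček 1995, §6.1:
instantaneous descriptions `Instan_M(u)` as tuples of sequences, `Consec_M(u, v)` a local
condition).  Standard semantics only (plain `ℕ` arithmetic, `/` and `%` by powers of two); the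
bounded-arithmetic side reproduces these functions by `Σᵇ₁` definitions elsewhere.

* `dcode w L` — a list of digits `< 2ʷ` as a number in base `2ʷ` (low digit first), with
  append / take / drop / digit-extraction lemmas;
* for a bundled machine `tm : FinTM2`: codes of symbols (`symCode`, injective on the finite
  effective alphabets `TM2Sim.IsSym` of `TM2Window.lean`), of labels and states, of stacks
  (`stkCode`: top of the stack = low digit) and of *local views* (`viewKey`: state, label and the
  top `depth` symbols of each stack, a number below a constant `2^keyWidth`);
* the **response** to a view (`View.resp`): the configuration after one total step
  (`TM2Sim.stepTotal`) executed on the view alone — by the window lemma of `TM2Window.lean`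
  (`TM2Sim.stepTotal_window`) the step on any configuration with that view replaces the top
  `depth` symbols of each stack by the response segments (`stepTotal_eq_resp`);
* the **configuration code** `cfgCode W c` (fields of width `W`: label, state, one per stack, in
  base `2ᵂ`) and the arithmetic step `stepCode` (read the key from the low bits of the fields, look
  the response up, splice), with **`stepCode_cfgCode`**: on codes of good configurations
  (`TM2Sim.Good`) with short enough stacks, `stepCode` is the code of the total step; hence the
  codes of a run padded to a time bound satisfy the arithmetic recursion (`cfgCode_iterate_succ`).

## References

* J. Krajíček, *Bounded Arithmetic, Propositional Logic and Complexity Theory*, CUP 1995, §6.1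
  (p. 86).
* S. R. Buss, *Bounded Arithmetic*, Bibliopolis 1986, Ch. 3.
* Window lemma, total step, effective alphabets: `Literature/Computability/Complexity/TM2Window.lean`
  (Sipser 2012, Thm. 9.30; Arora–Barak 2009, Thm. 6.6).
-/

namespace Literature.Computability.Complexity.TM2Arith

open Turing TM2Sim Function

/-! ## Digit codes in base `2ʷ` -/

/-- `dcode w L`: the number with base-`2ʷ` digits `L` (low digit first). [folklore] -/
def dcode (w : ℕ) (L : List ℕ) : ℕ := Nat.ofDigits (2 ^ w) L

/-- `dcode` of the empty list. [folklore] -/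
@[simp] theorem dcode_nil (w : ℕ) : dcode w [] = 0 := rfl

/-- `dcode` of a cons. [folklore] -/
theorem dcode_cons (w a : ℕ) (L : List ℕ) : dcode w (a :: L) = a + 2 ^ w * dcode w L := by
  simp [dcode, Nat.ofDigits_cons]

/-- **`dcode` of an append**: the second part is shifted by `w · |A|` bits. [folklore] -/
theorem dcode_append (w : ℕ) (A R : List ℕ) :
    dcode w (A ++ R) = dcode w A + 2 ^ (w * A.length) * dcode w R := by
  simp [dcode, Nat.ofDigits_append, pow_mul]

/-- A digit code with digits `< 2ʷ` is `< 2^(w·|L|)`. [folklore] -/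
theorem dcode_lt {w : ℕ} : ∀ {L : List ℕ}, (∀ x ∈ L, x < 2 ^ w) → dcode w L < 2 ^ (w * L.length)
  | [], _ => by simp
  | a :: L, h => by
    rw [dcode_cons, List.length_cons, Nat.mul_succ, pow_add]
    have ha : a < 2 ^ w := h a (by simp)
    have hL : dcode w L < 2 ^ (w * L.length) := dcode_lt fun x hx => h x (by simp [hx])
    calc a + 2 ^ w * dcode w L < 2 ^ w + 2 ^ w * dcode w L := by omega
      _ = 2 ^ w * (dcode w L + 1) := by ring
      _ ≤ 2 ^ w * 2 ^ (w * L.length) := Nat.mul_le_mul_left _ hL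
      _ = 2 ^ (w * L.length) * 2 ^ w := by ring

/-- **The low `i` digits**: `dcode w L % 2^(w·i) = dcode w (L.take i)`. [folklore] -/
theorem dcode_mod_pow {w : ℕ} {L : List ℕ} (h : ∀ x ∈ L, x < 2 ^ w) (i : ℕ) :
    dcode w L % 2 ^ (w * i) = dcode w (L.take i) := by
  conv_lhs => rw [← List.take_append_drop i L, dcode_append]
  by_cases hi : i ≤ L.length
  · rw [List.length_take, min_eq_left hi, Nat.add_mul_mod_self_left, Nat.mod_eq_of_lt]
    have := dcode_lt (w := w) (L := L.take i) fun x hx => h x (List.mem_of_mem_take hx)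
    rwa [List.length_take, min_eq_left hi] at this
  · push Not at hi
    rw [List.drop_eq_nil_of_le hi.le, dcode_nil, mul_zero, add_zero, List.take_of_length_le hi.le,
      Nat.mod_eq_of_lt]
    exact (dcode_lt h).trans_le (Nat.pow_le_pow_right (by norm_num) (Nat.mul_le_mul_left _ hi.le))

/-- **Dropping `i` digits**: `dcode w L / 2^(w·i) = dcode w (L.drop i)`. [folklore] -/
theorem dcode_div_pow {w : ℕ} {L : List ℕ} (h : ∀ x ∈ L, x < 2 ^ w) (i : ℕ) :
    dcode w L / 2 ^ (w * i) = dcode w (L.drop i) := by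
  conv_lhs => rw [← List.take_append_drop i L, dcode_append]
  by_cases hi : i ≤ L.length
  · rw [List.length_take, min_eq_left hi, Nat.add_mul_div_left _ _ (Nat.two_pow_pos _),
      Nat.div_eq_of_lt, zero_add]
    have := dcode_lt (w := w) (L := L.take i) fun x hx => h x (List.mem_of_mem_take hx)
    rwa [List.length_take, min_eq_left hi] at this
  · push Not at hi
    rw [List.drop_eq_nil_of_le hi.le, dcode_nil, mul_zero, add_zero, List.take_of_length_le hi.le,
      Nat.div_eq_of_lt]
    exact (dcode_lt h).trans_le (Nat.pow_le_pow_right (by norm_num) (Nat.mul_le_mul_left _ hi.le))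

/-- **Digit extraction**: `(dcode w L / 2^(w·i)) % 2ʷ = L[i]` (`0` beyond the end). [folklore] -/
theorem dcode_digit {w : ℕ} {L : List ℕ} (h : ∀ x ∈ L, x < 2 ^ w) (i : ℕ) :
    dcode w L / 2 ^ (w * i) % 2 ^ w = L.getD i 0 := by
  rw [dcode_div_pow h i]
  have h' : ∀ x ∈ L.drop i, x < 2 ^ w := fun x hx => h x (List.mem_of_mem_drop hx)
  have := dcode_mod_pow h' 1
  rw [mul_one] at this
  rw [this]
  cases hL : L.drop i with
  | nil =>
    simp only [List.take_nil, dcode_nil]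
    rw [List.getD_eq_default]
    exact List.drop_eq_nil_iff.1 hL
  | cons a L' =>
    simp only [List.take_succ_cons, List.take_zero, dcode_cons, dcode_nil, mul_zero, add_zero]
    have : L[i]? = some a := by
      rw [← List.head?_drop, hL]; rfl
    rw [List.getD_eq_getElem?_getD, this, Option.getD_some]

/-- `dcode` is injective on lists of digits `< 2ʷ` of the same length. [folklore] -/
theorem dcode_injOn_length {w : ℕ} : ∀ {L L' : List ℕ}, (∀ x ∈ L, x < 2 ^ w) → (∀ x ∈ L', x < 2 ^ w) →
    L.length = L'.length → dcode w L = dcode w L' → L = L'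
  | [], [], _, _, _, _ => rfl
  | [], _ :: _, _, _, h, _ => by simp at h
  | _ :: _, [], _, _, h, _ => by simp at h
  | a :: L, a' :: L', h, h', hlen, he => by
    rw [dcode_cons, dcode_cons] at he
    have ha : a < 2 ^ w := h a (by simp)
    have ha' : a' < 2 ^ w := h' a' (by simp)
    have h1 : a = a' := by
      have := congrArg (· % 2 ^ w) he
      simpa [Nat.add_mul_mod_self_left, Nat.mod_eq_of_lt ha, Nat.mod_eq_of_lt ha'] using this
    subst h1
    have h2 : dcode w L = dcode w L' := by
      have h2w : 0 < 2 ^ w := Nat.two_pow_pos w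
      have := congrArg (· / 2 ^ w) he
      simp only [Nat.add_mul_div_left _ _ h2w, Nat.div_eq_of_lt ha] at this
      simpa using this
    rw [dcode_injOn_length (fun x hx => h x (by simp [hx])) (fun x hx => h' x (by simp [hx]))
      (by simpa using hlen) h2]

/-- `dcode` of nonzero digits `< 2ʷ` determines the list (no length hypothesis): a code with all
digits in `[1, 2ʷ)` has no trailing-zero ambiguity. [folklore] -/
theorem dcode_inj_of_pos {w : ℕ} : ∀ {L L' : List ℕ}, (∀ x ∈ L, 0 < x ∧ x < 2 ^ w) →
    (∀ x ∈ L', 0 < x ∧ x < 2 ^ w) → dcode w L = dcode w L' → L = L'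
  | [], [], _, _, _ => rfl
  | [], a' :: L', _, h', he => by
    rw [dcode_nil, dcode_cons] at he
    have := (h' a' (by simp)).1
    omega
  | a :: L, [], h, _, he => by
    rw [dcode_nil, dcode_cons] at he
    have := (h a (by simp)).1
    omega
  | a :: L, a' :: L', h, h', he => by
    rw [dcode_cons, dcode_cons] at he
    have ha := h a (by simp)
    have ha' := h' a' (by simp)
    have h1 : a = a' := by
      have := congrArg (· % 2 ^ w) he
      simpa [Nat.add_mul_mod_self_left, Nat.mod_eq_of_lt ha.2, Nat.mod_eq_of_lt ha'.2] using this
    subst h1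
    have h2 : dcode w L = dcode w L' := by
      have h2w : 0 < 2 ^ w := Nat.two_pow_pos w
      have := congrArg (· / 2 ^ w) he
      simp only [Nat.add_mul_div_left _ _ h2w, Nat.div_eq_of_lt ha.2] at this
      simpa using this
    rw [dcode_inj_of_pos (fun x hx => h x (by simp [hx])) (fun x hx => h' x (by simp [hx])) h2]

/-! ## Codes of symbols, labels, states, stacks and views of a bundled machine -/

variable (tm : FinTM2)

open Classical in
/-- The finite effective alphabet of stack `k` (`TM2Sim.IsSym`, `TM2Window.lean`) as a `Finset`.
[folklore] -/
noncomputable def symSet (k : tm.K) : Finset (tm.Γ k) := (finite_isSym tm k).toFinset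

/-- Membership in `symSet`. [folklore] -/
theorem mem_symSet {k : tm.K} {γ : tm.Γ k} : γ ∈ symSet tm k ↔ IsSym tm k γ := by
  simp [symSet]

open Classical in
/-- **The code of a symbol** of stack `k`: its index in `symSet k` plus one (`0` codes "no symbol";
symbols that cannot occur get the junk code `0`). [folklore] -/
noncomputable def symCode (k : tm.K) (γ : tm.Γ k) : ℕ :=
  if h : γ ∈ (symSet tm) k then (((symSet tm) k).equivFin ⟨γ, h⟩ : ℕ) + 1 else 0

/-- The largest symbol code over all stacks. [folklore] -/
noncomputable def symMax : ℕ := (@Finset.univ tm.K tm.kFin).sup fun k => ((symSet tm) k).card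

/-- **The digit width** `b`: symbol codes are `< 2ᵇ`. [folklore] -/
noncomputable def symWidth : ℕ := Nat.size (symMax tm)

variable {tm}

/-- Codes of allowed symbols are positive. [folklore] -/
theorem symCode_pos {k : tm.K} {γ : tm.Γ k} (h : IsSym tm k γ) : 0 < (symCode tm) k γ := by
  rw [symCode, dif_pos ((mem_symSet tm).2 h)]; exact Nat.succ_pos _

/-- Codes of symbols are `≤ symMax`. [folklore] -/
theorem symCode_le_symMax (k : tm.K) (γ : tm.Γ k) : (symCode tm) k γ ≤ (symMax tm) := by
  unfold symCode
  split_ifs with h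
  · refine le_trans ?_ (Finset.le_sup (f := fun k => ((symSet tm) k).card) (@Finset.mem_univ _ tm.kFin k))
    exact (((symSet tm) k).equivFin ⟨γ, h⟩).isLt
  · exact Nat.zero_le _

/-- Codes of symbols are `< 2 ^ symWidth`. [folklore] -/
theorem symCode_lt (k : tm.K) (γ : tm.Γ k) : (symCode tm) k γ < 2 ^ (symWidth tm) :=
  (symCode_le_symMax k γ).trans_lt (Nat.lt_size_self _)

/-- `symCode k` is injective on the allowed symbols. [folklore] -/
theorem symCode_injOn (k : tm.K) : Set.InjOn (symCode tm k) {γ | IsSym tm k γ} := by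
  intro γ hγ γ' hγ' h
  rw [symCode, dif_pos ((mem_symSet tm).2 hγ), symCode, dif_pos ((mem_symSet tm).2 hγ')] at h
  have := ((symSet tm) k).equivFin.injective (Fin.ext (by simpa using h))
  simpa using this

variable (tm)

/-- **The code of a stack**: the base-`2ᵇ` number whose digits are the codes of its symbols, the
top of the stack being the low digit (Krajíček 1995, §6.1: stacks/tapes coded by sequences).
[cite: Krajicek1995, §6.1 (p. 86)] -/
noncomputable def stkCode {k : tm.K} (L : List (tm.Γ k)) : ℕ :=
  dcode (symWidth tm) (L.map ((symCode tm) k))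

/-- The code of a label: `none ↦ 0`, `some l ↦ index + 1`. [folklore] -/
noncomputable def labCode : Option tm.Λ → ℕ
  | none => 0
  | some l => (@Fintype.equivFin tm.Λ tm.ΛFin l : ℕ) + 1

/-- The code of a state: its index. [folklore] -/
noncomputable def stCode (v : tm.σ) : ℕ := (@Fintype.equivFin tm.σ tm.σFin v : ℕ)

/-- The width of the label field. [folklore] -/
noncomputable def labWidth : ℕ := Nat.size (@Fintype.card tm.Λ tm.ΛFin + 1)

/-- The width of the state field. [folklore] -/
noncomputable def stWidth : ℕ := Nat.size (@Fintype.card tm.σ tm.σFin)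

/-- The number of stacks. [folklore] -/
noncomputable def nStk : ℕ := @Fintype.card tm.K tm.kFin

/-- The `i`-th stack index. [folklore] -/
noncomputable def stkOf (i : Fin (nStk tm)) : tm.K := (@Fintype.equivFin tm.K tm.kFin).symm i

/-- The index of a stack. [folklore] -/
noncomputable def idxOf (k : tm.K) : Fin (nStk tm) := @Fintype.equivFin tm.K tm.kFin k

variable {tm}

/-- `stkOf (idxOf k) = k`. [folklore] -/
@[simp] theorem stkOf_idxOf (k : tm.K) : (stkOf tm) ((idxOf tm) k) = k := by simp [stkOf, idxOf]

/-- `idxOf (stkOf i) = i`. [folklore] -/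
@[simp] theorem idxOf_stkOf (i : Fin (nStk tm)) : (idxOf tm) ((stkOf tm) i) = i := by simp [stkOf, idxOf]

/-- Label codes are `< 2 ^ labWidth`. [folklore] -/
theorem labCode_lt (l : Option tm.Λ) : (labCode tm) l < 2 ^ (labWidth tm) := by
  cases l with
  | none => exact Nat.two_pow_pos _
  | some l =>
    refine lt_of_le_of_lt ?_ (Nat.lt_size_self _)
    exact Nat.succ_le_succ ((@Fintype.equivFin tm.Λ tm.ΛFin l).isLt.le)

/-- State codes are `< 2 ^ stWidth`. [folklore] -/
theorem stCode_lt (v : tm.σ) : (stCode tm) v < 2 ^ (stWidth tm) :=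
  lt_trans (@Fintype.equivFin tm.σ tm.σFin v).isLt (Nat.lt_size_self _)

/-- `labCode` is injective. [folklore] -/
theorem labCode_injective : Function.Injective (labCode tm) := by
  intro a b h
  cases a with
  | none => cases b with
    | none => rfl
    | some b => simp [labCode] at h
  | some a => cases b with
    | none => simp [labCode] at h
    | some b =>
      simp only [labCode, Nat.add_right_cancel_iff] at h
      exact congrArg some ((@Fintype.equivFin tm.Λ tm.ΛFin).injective (Fin.ext h))

/-- `stCode` is injective. [folklore] -/
theorem stCode_injective : Function.Injective (stCode tm) := fun _ _ h =>
  (@Fintype.equivFin tm.σ tm.σFin).injective (Fin.ext h)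

/-- The digits of a stack code are `< 2ᵇ`. [folklore] -/
theorem stkDigits_lt {k : tm.K} (L : List (tm.Γ k)) : ∀ x ∈ L.map ((symCode tm) k), x < 2 ^ (symWidth tm) := by
  intro x hx
  obtain ⟨γ, -, rfl⟩ := List.mem_map.1 hx
  exact symCode_lt k γ

/-- **Stack codes of appends**: `stkCode (A ++ R) = stkCode A + 2^(b·|A|) · stkCode R`. [folklore] -/
theorem stkCode_append {k : tm.K} (A R : List (tm.Γ k)) :
    (stkCode tm) (A ++ R) = (stkCode tm) A + 2 ^ ((symWidth tm) * A.length) * (stkCode tm) R := by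
  simp [stkCode, dcode_append]

/-- Stack codes are `< 2^(b·|L|)`. [folklore] -/
theorem stkCode_lt {k : tm.K} (L : List (tm.Γ k)) : (stkCode tm) L < 2 ^ ((symWidth tm) * L.length) := by
  simpa [stkCode] using dcode_lt (stkDigits_lt L)

/-- **The top `i` symbols**: `stkCode L % 2^(b·i) = stkCode (L.take i)`. [folklore] -/
theorem stkCode_mod {k : tm.K} (L : List (tm.Γ k)) (i : ℕ) :
    (stkCode tm) L % 2 ^ ((symWidth tm) * i) = (stkCode tm) (L.take i) := by
  simp only [stkCode, List.map_take]
  exact dcode_mod_pow (stkDigits_lt L) i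

/-- **Popping `i` symbols**: `stkCode L / 2^(b·i) = stkCode (L.drop i)`. [folklore] -/
theorem stkCode_div {k : tm.K} (L : List (tm.Γ k)) (i : ℕ) :
    (stkCode tm) L / 2 ^ ((symWidth tm) * i) = (stkCode tm) (L.drop i) := by
  simp only [stkCode, List.map_drop]
  exact dcode_div_pow (stkDigits_lt L) i

/-- Lists with equal images under a map injective across them are equal. [folklore] -/
theorem eq_of_map_eq_of_injOn {α β : Type*} {f : α → β} :
    ∀ {L L' : List α}, (∀ x ∈ L, ∀ y ∈ L', f x = f y → x = y) → L.map f = L'.map f → L = L'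
  | [], [], _, _ => rfl
  | [], _ :: _, _, h => by simp at h
  | _ :: _, [], _, h => by simp at h
  | a :: L, a' :: L', hinj, h => by
    simp only [List.map_cons, List.cons.injEq] at h
    obtain rfl : a = a' := hinj a (by simp) a' (by simp) h.1
    rw [eq_of_map_eq_of_injOn (fun x hx y hy => hinj x (by simp [hx]) y (by simp [hy])) h.2]

/-- Stack codes are injective on stacks of allowed symbols. [folklore] -/
theorem stkCode_injOn {k : tm.K} {L L' : List (tm.Γ k)} (hL : ∀ γ ∈ L, IsSym tm k γ)
    (hL' : ∀ γ ∈ L', IsSym tm k γ) (h : (stkCode tm) L = (stkCode tm) L') : L = L' := by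
  have h1 : L.map ((symCode tm) k) = L'.map ((symCode tm) k) := by
    refine dcode_inj_of_pos (w := (symWidth tm)) ?_ ?_ h
    · intro x hx
      obtain ⟨γ, hγ, rfl⟩ := List.mem_map.1 hx
      exact ⟨symCode_pos (hL γ hγ), symCode_lt k γ⟩
    · intro x hx
      obtain ⟨γ, hγ, rfl⟩ := List.mem_map.1 hx
      exact ⟨symCode_pos (hL' γ hγ), symCode_lt k γ⟩
  exact eq_of_map_eq_of_injOn (fun x hx y hy hxy => symCode_injOn k (hL x hx) (hL' y hy) hxy) h1

/-! ## Local views, their keys and responses -/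

variable (tm)

/-- A **local view** of a configuration: label, state and the top `depth` symbols of each
stack (Krajíček 1995, §6.1: the data the transition function reads). [cite: Krajicek1995, §6.1 (p. 86)] -/
structure View where
  /-- current label (`none` = halted) -/
  l : Option tm.Λ
  /-- current state -/
  v : tm.σ
  /-- the visible top segments of the stacks -/
  tops : ∀ k, List (tm.Γ k)

/-- The view of a configuration. [cite: Krajicek1995, §6.1 (p. 86)] -/
noncomputable def view (c : tm.Cfg) : View tm := ⟨c.l, c.var, fun k => (c.stk k).take (depth tm)⟩

/-- A view is *good* if its segments have length `≤ depth` and effective symbols. [folklore] -/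
def View.Good (V : View tm) : Prop :=
  ∀ k, (V.tops k).length ≤ depth tm ∧ ∀ γ ∈ V.tops k, IsSym tm k γ

/-- The code of the tuple of top segments: base `2^(b·d)`, one digit per stack. [folklore] -/
noncomputable def topsCode (tops : ∀ k, List (tm.Γ k)) : ℕ :=
  dcode ((symWidth tm) * depth tm) (List.ofFn fun i : Fin (nStk tm) => (stkCode tm) (tops ((stkOf tm) i)))

/-- **The key of a view**: `labCode + 2^wl · (stCode + 2^ws · topsCode)`. [folklore] -/
noncomputable def viewKey (V : View tm) : ℕ :=
  (labCode tm) V.l + 2 ^ (labWidth tm) * ((stCode tm) V.v + 2 ^ (stWidth tm) * (topsCode tm) V.tops)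

/-- The width of keys: `wl + ws + nStk · d · b`. [folklore] -/
noncomputable def keyWidth : ℕ := (labWidth tm) + (stWidth tm) + (nStk tm) * ((symWidth tm) * depth tm)

/-- **The response to a view**: the configuration after one total step executed on the view alone
(short stacks). [cite: Krajicek1995, §6.1 (p. 86)] -/
def View.resp (V : View tm) : tm.Cfg :=
  stepTotal tm ⟨V.l, V.v, V.tops⟩

variable {tm}

/-- The code of a segment of length `≤ d` is `< 2^(b·d)`. [folklore] -/
theorem stkCode_lt_of_length_le {k : tm.K} {L : List (tm.Γ k)} {d : ℕ} (h : L.length ≤ d) :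
    (stkCode tm) L < 2 ^ ((symWidth tm) * d) :=
  (stkCode_lt L).trans_le (Nat.pow_le_pow_right (by norm_num) (Nat.mul_le_mul_left _ h))

/-- `topsCode` of a good view is `< 2^(nStk·b·d)`. [folklore] -/
theorem topsCode_lt {V : View tm} (hV : V.Good) :
    (topsCode tm) V.tops < 2 ^ ((nStk tm) * ((symWidth tm) * depth tm)) := by
  have := dcode_lt (w := (symWidth tm) * depth tm)
    (L := List.ofFn fun i : Fin (nStk tm) => (stkCode tm) (V.tops ((stkOf tm) i))) ?_
  · simpa [topsCode, List.length_ofFn, mul_comm] using this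
  · intro x hx
    obtain ⟨i, rfl⟩ := (List.mem_ofFn' _ _).1 hx
    exact stkCode_lt_of_length_le (hV _).1

/-- **Keys are below `2^keyWidth`.** [folklore] -/
theorem viewKey_lt {V : View tm} (hV : V.Good) : (viewKey tm) V < 2 ^ (keyWidth tm) := by
  have h1 := labCode_lt V.l
  have h2 := stCode_lt V.v
  have h3 := topsCode_lt hV
  unfold viewKey keyWidth
  set wl := (labWidth tm)
  set ws := (stWidth tm)
  set wt := (nStk tm) * ((symWidth tm) * depth tm)
  calc (labCode tm) V.l + 2 ^ wl * ((stCode tm) V.v + 2 ^ ws * (topsCode tm) V.tops)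
      < 2 ^ wl + 2 ^ wl * ((stCode tm) V.v + 2 ^ ws * (topsCode tm) V.tops) := by omega
    _ = 2 ^ wl * ((stCode tm) V.v + 2 ^ ws * (topsCode tm) V.tops + 1) := by ring
    _ ≤ 2 ^ wl * (2 ^ ws * ((topsCode tm) V.tops + 1)) := Nat.mul_le_mul_left _ (by nlinarith)
    _ ≤ 2 ^ wl * (2 ^ ws * 2 ^ wt) := Nat.mul_le_mul_left _ (Nat.mul_le_mul_left _ h3)
    _ = 2 ^ (wl + ws + wt) := by rw [pow_add, pow_add]; ring

/-- **Keys of good views are injective.** [folklore] -/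
theorem viewKey_injOn {V V' : View tm} (hV : V.Good) (hV' : V'.Good) (h : (viewKey tm) V = (viewKey tm) V') :
    V = V' := by
  have hl := labCode_lt V.l
  have hl' := labCode_lt V'.l
  have hs := stCode_lt V.v
  have hs' := stCode_lt V'.v
  unfold viewKey at h
  have e1 : (labCode tm) V.l = (labCode tm) V'.l := by
    have := congrArg (· % 2 ^ (labWidth tm)) h
    simpa [Nat.add_mul_mod_self_left, Nat.mod_eq_of_lt hl, Nat.mod_eq_of_lt hl'] using this
  have e23 : (stCode tm) V.v + 2 ^ (stWidth tm) * (topsCode tm) V.tops =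
      (stCode tm) V'.v + 2 ^ (stWidth tm) * (topsCode tm) V'.tops := by
    have := congrArg (· / 2 ^ (labWidth tm)) h
    simpa [Nat.add_mul_div_left _ _ (Nat.two_pow_pos _), Nat.div_eq_of_lt hl, Nat.div_eq_of_lt hl']
      using this
  have e2 : (stCode tm) V.v = (stCode tm) V'.v := by
    have := congrArg (· % 2 ^ (stWidth tm)) e23
    simpa [Nat.add_mul_mod_self_left, Nat.mod_eq_of_lt hs, Nat.mod_eq_of_lt hs'] using this
  have e3 : (topsCode tm) V.tops = (topsCode tm) V'.tops := by
    have := congrArg (· / 2 ^ (stWidth tm)) e23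
    simpa [Nat.add_mul_div_left _ _ (Nat.two_pow_pos _), Nat.div_eq_of_lt hs, Nat.div_eq_of_lt hs']
      using this
  have e4 : V.tops = V'.tops := by
    have hlist := dcode_injOn_length (w := (symWidth tm) * depth tm) ?_ ?_ (by simp) e3
    · have hfg := List.ofFn_injective hlist
      funext k
      obtain ⟨i, rfl⟩ : ∃ i, (stkOf tm) i = k := ⟨(idxOf tm) k, stkOf_idxOf k⟩
      exact stkCode_injOn (hV _).2 (hV' _).2 (congrFun hfg i)
    · intro x hx
      obtain ⟨i, rfl⟩ := (List.mem_ofFn' _ _).1 hx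
      exact stkCode_lt_of_length_le (hV _).1
    · intro x hx
      obtain ⟨i, rfl⟩ := (List.mem_ofFn' _ _).1 hx
      exact stkCode_lt_of_length_le (hV' _).1
  obtain ⟨l, v, tops⟩ := V
  obtain ⟨l', v', tops'⟩ := V'
  simp only at e1 e2 e4
  cases labCode_injective e1
  cases stCode_injective e2
  cases e4
  rfl

/-- The view of a configuration with allowed stacks is good. [folklore] -/
theorem good_view {c : tm.Cfg} (hc : Good tm c) : ((view tm) c).Good :=
  fun k => ⟨List.length_take_le _ _, fun γ hγ => hc k γ (List.mem_of_mem_take hγ)⟩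

/-- **The step is determined by the view** (the window lemma `TM2Sim.stepTotal_window`): the new
configuration has the label and state of the response and stacks "response segment ++ rest below
the view" (Krajíček 1995, §6.1). [cite: Krajicek1995, §6.1 (p. 86)] -/
theorem stepTotal_eq_resp (c : tm.Cfg) :
    stepTotal tm c =
      ⟨((view tm) c).resp.l, ((view tm) c).resp.var,
        fun k => ((view tm) c).resp.stk k ++ (c.stk k).drop (depth tm)⟩ :=
  stepTotal_window tm c (depth tm) le_rfl

/-- The response segments have length `≤ |tops k| + depth ≤ 2·depth`. [folklore] -/
theorem length_resp_stk_le {V : View tm} (hV : V.Good) (k : tm.K) :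
    (V.resp.stk k).length ≤ depth tm + depth tm :=
  (length_stepTotal_le tm ⟨V.l, V.v, V.tops⟩ k).trans (Nat.add_le_add_right (hV k).1 _)

/-! ## The response table, indexed by keys -/

variable (tm)

open Classical in
/-- **The response table**: for a number `κ`, the response of the good view with key `κ` if there
is one (it is unique, `viewKey_injOn`), as numbers: new label code, new state code, and for each
stack the code and the length of the new top segment; junk (`0`) for other `κ`. [folklore] -/
noncomputable def respLab (κ : ℕ) : ℕ :=
  if h : ∃ V : View tm, V.Good ∧ (viewKey tm) V = κ then (labCode tm) (Classical.choose h).resp.l else 0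

open Classical in
/-- The new state code of the response table. [folklore] -/
noncomputable def respSt (κ : ℕ) : ℕ :=
  if h : ∃ V : View tm, V.Good ∧ (viewKey tm) V = κ then (stCode tm) (Classical.choose h).resp.var else 0

open Classical in
/-- The code of the new top segment of stack `i` of the response table. [folklore] -/
noncomputable def respSeg (κ : ℕ) (i : Fin (nStk tm)) : ℕ :=
  if h : ∃ V : View tm, V.Good ∧ (viewKey tm) V = κ then (stkCode tm) ((Classical.choose h).resp.stk ((stkOf tm) i))
  else 0

open Classical in
/-- The length of the new top segment of stack `i` of the response table. [folklore] -/
noncomputable def respLen (κ : ℕ) (i : Fin (nStk tm)) : ℕ :=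
  if h : ∃ V : View tm, V.Good ∧ (viewKey tm) V = κ then ((Classical.choose h).resp.stk ((stkOf tm) i)).length
  else 0

variable {tm}

/-- The chosen view for the key of a good view is that view. [folklore] -/
theorem choose_viewKey_eq {V : View tm} (hV : V.Good)
    (h : ∃ V' : View tm, V'.Good ∧ (viewKey tm) V' = (viewKey tm) V) : Classical.choose h = V :=
  viewKey_injOn (Classical.choose_spec h).1 hV (Classical.choose_spec h).2

/-- The response table at the key of a good view: label. [folklore] -/
theorem respLab_viewKey {V : View tm} (hV : V.Good) : (respLab tm) ((viewKey tm) V) = (labCode tm) V.resp.l := by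
  have h : ∃ V' : View tm, V'.Good ∧ (viewKey tm) V' = (viewKey tm) V := ⟨V, hV, rfl⟩
  rw [respLab, dif_pos h, choose_viewKey_eq hV h]

/-- The response table at the key of a good view: state. [folklore] -/
theorem respSt_viewKey {V : View tm} (hV : V.Good) : (respSt tm) ((viewKey tm) V) = (stCode tm) V.resp.var := by
  have h : ∃ V' : View tm, V'.Good ∧ (viewKey tm) V' = (viewKey tm) V := ⟨V, hV, rfl⟩
  rw [respSt, dif_pos h, choose_viewKey_eq hV h]

/-- The response table at the key of a good view: segment codes. [folklore] -/
theorem respSeg_viewKey {V : View tm} (hV : V.Good) (i : Fin (nStk tm)) :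
    (respSeg tm) ((viewKey tm) V) i = (stkCode tm) (V.resp.stk ((stkOf tm) i)) := by
  have h : ∃ V' : View tm, V'.Good ∧ (viewKey tm) V' = (viewKey tm) V := ⟨V, hV, rfl⟩
  rw [respSeg, dif_pos h, choose_viewKey_eq hV h]

/-- The response table at the key of a good view: segment lengths. [folklore] -/
theorem respLen_viewKey {V : View tm} (hV : V.Good) (i : Fin (nStk tm)) :
    (respLen tm) ((viewKey tm) V) i = (V.resp.stk ((stkOf tm) i)).length := by
  have h : ∃ V' : View tm, V'.Good ∧ (viewKey tm) V' = (viewKey tm) V := ⟨V, hV, rfl⟩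
  rw [respLen, dif_pos h, choose_viewKey_eq hV h]

/-- Segment lengths in the table are `≤ 2·depth`. [folklore] -/
theorem respLen_le (κ : ℕ) (i : Fin (nStk tm)) : (respLen tm) κ i ≤ depth tm + depth tm := by
  unfold respLen
  split_ifs with h
  · exact length_resp_stk_le (Classical.choose_spec h).1 _
  · exact Nat.zero_le _

/-- Segment codes in the table are `< 2^(b · respLen)`. [folklore] -/
theorem respSeg_lt (κ : ℕ) (i : Fin (nStk tm)) :
    (respSeg tm) κ i < 2 ^ ((symWidth tm) * (respLen tm) κ i) := by
  unfold respSeg respLen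
  split_ifs with h
  · exact stkCode_lt _
  · exact Nat.two_pow_pos _

/-! ## Configuration codes and the arithmetic step -/

variable (tm)

/-- The fields of a configuration: label code, state code, and the stack codes. [cite: Krajicek1995, §6.1 (p. 86)] -/
noncomputable def fields (c : tm.Cfg) : List ℕ :=
  [(labCode tm) c.l, (stCode tm) c.var] ++ List.ofFn fun i : Fin (nStk tm) => (stkCode tm) (c.stk ((stkOf tm) i))

/-- **The code of a configuration** with fields of width `W`: `dcode W (fields c)` (Krajíček 1995,
§6.1: an instantaneous description is a tuple of sequences). [cite: Krajicek1995, §6.1 (p. 86)] -/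
noncomputable def cfgCode (W : ℕ) (c : tm.Cfg) : ℕ := dcode W ((fields tm) c)

/-- Field `i` of a code with fields of width `W`. [folklore] -/
def field (W x i : ℕ) : ℕ := x / 2 ^ (W * i) % 2 ^ W

/-- **The key read off a code**: from the low bits of the fields. [folklore] -/
noncomputable def codeKey (W x : ℕ) : ℕ :=
  field W x 0 + 2 ^ (labWidth tm) * (field W x 1 + 2 ^ (stWidth tm) *
    dcode ((symWidth tm) * depth tm)
      (List.ofFn fun i : Fin (nStk tm) => field W x (i + 2) % 2 ^ ((symWidth tm) * depth tm)))

/-- The new stack field `i`: response segment spliced under the popped old field, truncated to `W`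
bits. [folklore] -/
noncomputable def newStkField (W x : ℕ) (i : Fin (nStk tm)) : ℕ :=
  ((respSeg tm) ((codeKey tm) W x) i +
      2 ^ ((symWidth tm) * (respLen tm) ((codeKey tm) W x) i) *
        (field W x (i + 2) / 2 ^ ((symWidth tm) * depth tm))) % 2 ^ W

/-- **The arithmetic step** on codes: read the key, look the response up, splice (Krajíček 1995,
§6.1, `Consec_M`). [cite: Krajicek1995, §6.1 (p. 86)] -/
noncomputable def stepCode (W x : ℕ) : ℕ :=
  dcode W ([(respLab tm) ((codeKey tm) W x), (respSt tm) ((codeKey tm) W x)] ++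
    List.ofFn ((newStkField tm) W x))

variable {tm}

/-- **A configuration fits in width `W`**: the label and state fields fit and every stack, extended
by `depth` more symbols, still fits. [folklore] -/
def Fits (W : ℕ) (c : tm.Cfg) : Prop :=
  (labWidth tm) ≤ W ∧ (stWidth tm) ≤ W ∧ ∀ k, (symWidth tm) * ((c.stk k).length + depth tm) ≤ W

/-- The fields of a fitting configuration are `< 2ᵂ`. [folklore] -/
theorem fields_lt {W : ℕ} {c : tm.Cfg} (h : Fits W c) : ∀ x ∈ (fields tm) c, x < 2 ^ W := by
  intro x hx
  simp only [fields, List.cons_append, List.nil_append, List.mem_cons, List.mem_ofFn] at hx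
  rcases hx with rfl | rfl | ⟨i, rfl⟩
  · exact (labCode_lt _).trans_le (Nat.pow_le_pow_right (by norm_num) h.1)
  · exact (stCode_lt _).trans_le (Nat.pow_le_pow_right (by norm_num) h.2.1)
  · exact (stkCode_lt _).trans_le (Nat.pow_le_pow_right (by norm_num)
      ((Nat.mul_le_mul_left _ (Nat.le_add_right _ _)).trans (h.2.2 _)))

/-- Field extraction from a configuration code: label. [folklore] -/
theorem field_cfgCode_zero {W : ℕ} {c : tm.Cfg} (h : Fits W c) :
    field W ((cfgCode tm) W c) 0 = (labCode tm) c.l := by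
  rw [field, cfgCode, dcode_digit (fields_lt h)]; rfl

/-- Field extraction from a configuration code: state. [folklore] -/
theorem field_cfgCode_one {W : ℕ} {c : tm.Cfg} (h : Fits W c) :
    field W ((cfgCode tm) W c) 1 = (stCode tm) c.var := by
  rw [field, cfgCode, dcode_digit (fields_lt h)]; rfl

/-- Field extraction from a configuration code: stacks. [folklore] -/
theorem field_cfgCode_stk {W : ℕ} {c : tm.Cfg} (h : Fits W c) (i : Fin (nStk tm)) :
    field W ((cfgCode tm) W c) (i + 2) = (stkCode tm) (c.stk ((stkOf tm) i)) := by
  rw [field, cfgCode, dcode_digit (fields_lt h), fields]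
  simp [List.getD_eq_getElem?_getD]

/-- **The key read off a configuration code is the key of its view.** [folklore] -/
theorem codeKey_cfgCode {W : ℕ} {c : tm.Cfg} (h : Fits W c) :
    (codeKey tm) W ((cfgCode tm) W c) = (viewKey tm) ((view tm) c) := by
  simp only [codeKey, field_cfgCode_zero h, field_cfgCode_one h, field_cfgCode_stk h, viewKey, view,
    topsCode, stkCode_mod]

/-- **`stepCode` on the code of a fitting configuration with allowed stacks is the code of its
total step** (Krajíček 1995, §6.1: `Consec_M(u, v)` holds iff `v` codes the successor of `u`).
[cite: Krajicek1995, §6.1 (p. 86)] -/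
theorem stepCode_cfgCode {W : ℕ} {c : tm.Cfg} (h : Fits W c) (hc : Good tm c) :
    (stepCode tm) W ((cfgCode tm) W c) = (cfgCode tm) W (stepTotal tm c) := by
  have hV : ((view tm) c).Good := good_view hc
  have hkey := codeKey_cfgCode h
  have h1 : (respLab tm) ((codeKey tm) W ((cfgCode tm) W c)) = (labCode tm) ((view tm) c).resp.l := by
    rw [hkey, respLab_viewKey hV]
  have h2 : (respSt tm) ((codeKey tm) W ((cfgCode tm) W c)) = (stCode tm) ((view tm) c).resp.var := by
    rw [hkey, respSt_viewKey hV]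
  have h3 : ∀ i, (newStkField tm) W ((cfgCode tm) W c) i =
      (stkCode tm) (((view tm) c).resp.stk ((stkOf tm) i) ++ (c.stk ((stkOf tm) i)).drop (depth tm)) := by
    intro i
    rw [newStkField, hkey, respSeg_viewKey hV, respLen_viewKey hV, field_cfgCode_stk h, stkCode_div,
      ← stkCode_append, Nat.mod_eq_of_lt]
    -- the new stack fits
    refine (stkCode_lt _).trans_le (Nat.pow_le_pow_right (by norm_num) ?_)
    rw [List.length_append, List.length_drop]
    refine le_trans (Nat.mul_le_mul_left _ ?_) (h.2.2 ((stkOf tm) i))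
    have h2 : (((view tm) c).resp.stk ((stkOf tm) i)).length ≤
        (((view tm) c).tops ((stkOf tm) i)).length + depth tm :=
      length_stepTotal_le tm ⟨((view tm) c).l, ((view tm) c).v, ((view tm) c).tops⟩ ((stkOf tm) i)
    simp only [view, List.length_take] at h2 ⊢
    omega
  rw [stepTotal_eq_resp c]
  unfold stepCode
  rw [h1, h2, funext h3]
  rfl

/-! ## Codes along a run padded by the total step -/

/-- Fitting from a bound on the stack lengths: if every stack of `c` has length `≤ n + t·d` and
`b·(n + (t+1)·d) ≤ W` (and the label/state fields fit) then `c` fits in width `W`. [folklore] -/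
theorem fits_of_length_le {W n t : ℕ} {c : tm.Cfg} (hl : (labWidth tm) ≤ W)
    (hs : (stWidth tm) ≤ W) (hW : (symWidth tm) * (n + (t + 1) * depth tm) ≤ W)
    (hc : ∀ k, (c.stk k).length ≤ n + t * depth tm) : Fits W c := by
  refine ⟨hl, hs, fun k => le_trans (Nat.mul_le_mul_left _ ?_) hW⟩
  have := hc k
  rw [add_mul, one_mul, ← add_assoc]
  omega

/-- **The codes of a run padded by the total step satisfy the arithmetic recursion**: if all stacks of the start
configuration have length `≤ n` and `b·(n + T·d + d) ≤ W`, then for `t < T` the code of the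
`(t+1)`-st configuration is `stepCode` of the code of the `t`-th (Krajíček 1995, Lemma 6.1.1: the
computation is the unique sequence satisfying `Consec_M`). [cite: Krajicek1995, Lemma 6.1.1 (p. 86)] -/
theorem cfgCode_iterate_succ {W n T : ℕ} {c : tm.Cfg} (hl : (labWidth tm) ≤ W)
    (hs : (stWidth tm) ≤ W) (hW : (symWidth tm) * (n + T * depth tm + depth tm) ≤ W)
    (hc : ∀ k, (c.stk k).length ≤ n) (hok : Good tm c) {t : ℕ} (ht : t < T) :
    (cfgCode tm) W ((stepTotal tm)^[t + 1] c) =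
      (stepCode tm) W ((cfgCode tm) W ((stepTotal tm)^[t] c)) := by
  rw [Function.iterate_succ_apply']
  symm
  refine stepCode_cfgCode (fits_of_length_le (n := n) (t := t) hl hs ?_ fun k => ?_) ?_
  · refine le_trans (Nat.mul_le_mul_left _ ?_) hW
    have : (t + 1) * depth tm ≤ T * depth tm + depth tm := by
      rw [add_mul, one_mul]; exact Nat.add_le_add_right (Nat.mul_le_mul_right _ ht.le) _
    omega
  · calc _ ≤ (c.stk k).length + depth tm * t := length_iterate_stepTotal_le tm c k t
      _ ≤ n + t * depth tm := by rw [Nat.mul_comm]; exact Nat.add_le_add_right (hc k) _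
  · exact Good.iterate tm hok t

/-- Fitting of the configurations of such a run (for `t ≤ T`). [folklore] -/
theorem fits_iterate {W n T : ℕ} {c : tm.Cfg} (hl : (labWidth tm) ≤ W)
    (hs : (stWidth tm) ≤ W) (hW : (symWidth tm) * (n + T * depth tm + depth tm) ≤ W)
    (hc : ∀ k, (c.stk k).length ≤ n) {t : ℕ} (ht : t ≤ T) :
    Fits W ((stepTotal tm)^[t] c) := by
  refine fits_of_length_le (n := n) (t := t) hl hs ?_ fun k => ?_
  · refine le_trans (Nat.mul_le_mul_left _ ?_) hW
    have : (t + 1) * depth tm ≤ T * depth tm + depth tm := by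
      rw [add_mul, one_mul]; exact Nat.add_le_add_right (Nat.mul_le_mul_right _ ht) _
    omega
  · calc _ ≤ (c.stk k).length + depth tm * t := length_iterate_stepTotal_le tm c k t
      _ ≤ n + t * depth tm := by rw [Nat.mul_comm]; exact Nat.add_le_add_right (hc k) _

end Literature.Computability.Complexity.TM2Arith
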